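import Mathlib
import Summits.CriticalPhenomena.CardyFormulaZ2.Theorems.CardySelfRefinementDefs
import Summits.CriticalPhenomena.CardyFormulaZ2.Theorems.CardySelfRefinementGradientComparabilityStubSlopeBoundsCornerTransferCell
import Summits.CriticalPhenomena.CardyFormulaZ2.Theorems.CardySelfRefinementGradientComparabilityStubSlopeBoundsCornerPenaltySum
import Summits.CriticalPhenomena.CardyFormulaZ2.Theorems.CardySelfRefinementGradientComparabilityStubNonAxialShareBulk
import HarnessLib

/-!
# Crux `GradientComparability` (stmt-CriticalPhenomena-10269), line `monotone-product-coordinates` —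
# stub `stub_cornerLocalSlope` (LOC), corner transfer (B″₂), part 3: the measure bound — a far
# interior edge of `M_2(ρ,c)` is pivotal at most `585/(1−c)` times as often as the side bundles of
# its cell are set-pivotal

Route `CardySelfRefinement`, sub-problem `CriticalPhenomena/CardyFormulaZ2`; vocabulary from
`CardySelfRefinementDefs` (`ax tb prm M Aloc edgeOf dirVec`); the pointwise corner transfer of part 2
(`exists_setPivotal_side_of_isPivotal_two`, `centre_edge_notMem_bundleSet`), the cheap moves
`one_sub_mul_real_sdiff_mem_le` (closing an interior edge costs `1/(1−c)`) and
`real_union_bundle_mem_le` (forcing a bundle open costs `2^{k+1} = 8`) of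
`…StubSlopeBoundsCorner{Penalty,PenaltySum}`, and `exists_eq_edgeOf_of_adj` (`…StubNonAxialShareBulk`).

## Mathematics

Brick (B″₂) of the signed domination (SD) behind the local corner slope bound: for `k = 2`, any
real `ρ` (the corner `ρ = 1` included — no selector is touched), `0 ≤ c < 1`, a cell of base `z`
whose centre `w = 2z + (1,1)` is drawn at distance `≥ r ≥ 20η` from every side of every quad of the
family (any `m`), and a spoke `e = {w, μ}` of the cell,

`M_2(ρ,c)(e pivotal for Aloc) ≤ 585/(1−c) · ( M(PIV_S) + M(PIV_E) + M(PIV_N) + M(PIV_W) )`,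

`PIV_B = {ω ∪ B ∈ Aloc ∧ ω ∖ B ∉ Aloc}` the set-pivotality of the side bundles `S = (z,0)`,
`E = (z+e₀,1)`, `N = (z+e₁,0)`, `W = (z,1)` — the currency `N_S` of the penalty half
`Drho_add_mul_Dc_ge_of_far`.  Proof (`real_isPivotal_spoke_le_two`): by part 2,
`{e pivotal} ⊆ ⋃_{j ≤ 4} {ω ∖ {e} ∪ B₁ ∪ ⋯ ∪ B_{j−1} ∈ PIV_{B_j}}`; closing the interior edge `e`
costs `1/(1−c)` and each tying `8`, so the four terms cost `(1 + 8 + 64 + 512)/(1−c)`.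
`real_isPivotal_interior_le_two` (registered) restates this for a non-axial `edgeOf (v, d)` with both
ends far, the cell being `tb 2 (v, d)` (the form of the non-axial window edges `Wn` of
`stub_Dc_eq_sum_pivotal`): summing over the far interior edges and regrouping by bundles (each
bundle is a side of two cells with four spokes each) gives the corner transfer
`∂cP_far ≤ 8 · 585/(1−c) · N_{S'}` with `S'` the selectors of the sides of far cells.
-/

noncomputable section

namespace Summit.CriticalPhenomena.CardyFormulaZ2.Theorems.CardySelfRefinement

open scoped Topology
open Filter Set MeasureTheory
open Literature.Probability.LatticeModels Literature.Probability.Percolation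
open Literature.Probability.Percolation.QuadCrossing
open Summit.CriticalPhenomena.CardyFormulaZ2.Theses.CardySelfRefinement

/-! ## A spoke is a non-axial `edgeOf` -/

/-- A spoke `{2z + (1,1), μ}` of the `k = 2` cell of base `z` is `edgeOf (v, d)` for a NON-AXIAL
`(v, d)` (no edge at the centre is axial). -/
theorem exists_eq_edgeOf_not_ax_of_adj_centre {k : ℕ} (hk : k = 2) (z : Site 2) {μ : Site 2}
    (hwμ : (zdGraph 2).Adj (fun l => (k : ℤ) * z l + 1) μ) :
    ∃ (v : Site 2) (d : Fin 2), s((fun l => (k : ℤ) * z l + 1), μ) = edgeOf (v, d) ∧ ¬ ax k (v, d) := by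
  have key : ∀ (v : Site 2) (d : Fin 2), s((fun l => (k : ℤ) * z l + 1), μ) = edgeOf (v, d) → ¬ ax k (v, d) :=
    fun v d hvd hax => centre_edge_notMem_bundleSet hk z μ (tb k (v, d)) d ⟨(v, d), ⟨hax, rfl, rfl⟩, hvd.symm⟩
  obtain ⟨d, hd | hd⟩ := exists_eq_edgeOf_of_adj hwμ
  · exact ⟨_, d, hd, key _ d hd⟩
  · exact ⟨_, d, hd, key _ d hd⟩

/-! ## The measure bound per spoke -/

/-- **Corner transfer (B″₂), per spoke.**  For `k = 2`, `0 < η`, `20η ≤ r`, any real `ρ`,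
`0 ≤ c < 1`, a cell of base `z` with centre `w = 2z + (1,1)` drawn `r`-far from every side of every
quad, and a spoke `{w, μ}`:
`M_2(ρ,c)({w,μ} pivotal for Aloc) ≤ 585/(1−c) · (M(PIV_S) + M(PIV_E) + M(PIV_N) + M(PIV_W))` with the
side bundles `S = (z,0)`, `E = (z+e₀,1)`, `N = (z+e₁,0)`, `W = (z,1)` (pointwise transfer of part 2,
closing `e` at cost `1/(1−c)`, tying at cost `8` per bundle). -/
theorem real_isPivotal_spoke_le_two : ∀ (k m : ℕ), k = 2 → ∀ (F : Fin m → Quad (Set.univ : Set ℂ)) (η r : ℝ), 0 < η → 20 * η ≤ r → ∀ (ρ c : ℝ), c ∈ Set.Ico (0 : ℝ) 1 → ∀ (z μ : Site 2), (zdGraph 2).Adj (fun l => (k : ℤ) * z l + 1) μ → (∀ (i : Fin m) (j : Fin 4), ∀ p ∈ (F i).side j, r ≤ dist ((η : ℂ) * squareLatticeEmbedding.z (fun l => (k : ℤ) * z l + 1)) p) → (M k ρ c).real {ω | IsPivotal (Aloc m F η) s((fun l => (k : ℤ) * z l + 1), μ) ω} ≤ 585 / (1 - c) * ((M k ρ c).real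 {ω | ω ∪ edgeOf '' {vd : Site 2 × Fin 2 | ax k vd ∧ tb k vd = z ∧ vd.2 = 0} ∈ Aloc m F η ∧ ω \ edgeOf '' {vd : Site 2 × Fin 2 | ax k vd ∧ tb k vd = z ∧ vd.2 = 0} ∉ Aloc m F η} + (M k ρ c).real {ω | ω ∪ edgeOf '' {vd : Site 2 × Fin 2 | ax k vd ∧ tb k vd = z + Pi.single 0 1 ∧ vd.2 = 1} ∈ Aloc m F η ∧ ω \ edgeOf '' {vd : Site 2 × Fin 2 | ax k vd ∧ tb k vd = z + Pi.single 0 1 ∧ vd.2 = 1} ∉ Aloc m F η} + (M k ρ c).real {ω | ω ∪ edgeOf '' {vd : Site 2 × Fin 2 | ax k vd ∧ tb k vd = z + Pi.single 1 1 ∧ vd.2 = 0} ∈ Aloc m F η ∧ ω \ edgeOf '' {vd : Site 2 × Fin 2 | ax k vd ∧ tb k vd = z + Pi.single 1 1 ∧ vd.2 = 0} ∉ Aloc m F η} + (M k ρ c).real {ω | ω ∪ edgeOf '' {vd : Site 2 × Fin 2 | ax k vd ∧ tb k vd = z ∧ vd.2 = 1} ∈ Aloc m F η ∧ ω \ edgeOf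 '' {vd : Site 2 × Fin 2 | ax k vd ∧ tb k vd = z ∧ vd.2 = 1} ∉ Aloc m F η}) := by
  intro k m hk F η r hη hηr ρ c hc z μ hwμ hfar
  subst hk
  haveI := isProbabilityMeasure_M 2 ρ c
  set w : Site 2 := fun l => ((2 : ℕ) : ℤ) * z l + 1 with hw_def
  set A : Set (BondConfig (Site 2)) := Aloc m F η with hA
  have hAm : MeasurableSet A := measurableSet_Aloc m F hη.ne'
  set Bs : Site 2 → Fin 2 → Set (Sym2 (Site 2)) :=
    fun t d => edgeOf '' {vd : Site 2 × Fin 2 | ax 2 vd ∧ tb 2 vd = t ∧ vd.2 = d} with hBs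
  set PIV : Set (Sym2 (Site 2)) → Set (BondConfig (Site 2)) := fun B => {ω | ω ∪ B ∈ A ∧ ω \ B ∉ A} with hPIV
  -- measurability
  have hPIVm : ∀ B, MeasurableSet (PIV B) := fun B =>
    ((measurable_set_iff.2 fun x => (measurable_set_mem x).or measurable_const :
        Measurable fun ω : BondConfig (Site 2) => ω ∪ B) hAm).inter
      ((measurable_set_iff.2 fun x => (measurable_set_mem x).and measurable_const :
        Measurable fun ω : BondConfig (Site 2) => ω \ B) hAm).compl
  have hUm : ∀ (B : Set (Sym2 (Site 2))) {X : Set (BondConfig (Site 2))}, MeasurableSet X →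
      MeasurableSet {ω : BondConfig (Site 2) | ω ∪ B ∈ X} := fun B X hX =>
    (measurable_set_iff.2 fun x => (measurable_set_mem x).or measurable_const :
      Measurable fun ω : BondConfig (Site 2) => ω ∪ B) hX
  -- the spoke as a non-axial `edgeOf`, and the cost of closing it
  obtain ⟨v, d, hvd, hax⟩ := exists_eq_edgeOf_not_ax_of_adj_centre rfl z hwμ
  have hc1 : 0 < 1 - c := by linarith [hc.2]
  have hclose : ∀ {X : Set (BondConfig (Site 2))}, MeasurableSet X →
      (M 2 ρ c).real {ω | ω \ {s(w, μ)} ∈ X} ≤ 1 / (1 - c) * (M 2 ρ c).real X := by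
    intro X hX
    have hp : (prm 2 ρ c (v, d, 0) : ℝ) = c := by
      simp [prm, hax, Set.projIcc_of_mem _ (Set.Ico_subset_Icc_self hc)]
    have h := one_sub_mul_real_sdiff_mem_le 2 hax ρ c hX
    rw [hp, ← hvd] at h
    rw [one_div, ← div_eq_inv_mul, le_div_iff₀ hc1]
    linarith
  -- the cost of tying a bundle
  have htie : ∀ (t : Site 2) (dd : Fin 2) {X : Set (BondConfig (Site 2))}, MeasurableSet X →
      (M 2 ρ c).real {ω | ω ∪ Bs t dd ∈ X} ≤ 8 * (M 2 ρ c).real X := fun t dd X hX =>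
    calc (M 2 ρ c).real {ω | ω ∪ Bs t dd ∈ X} ≤ 2 ^ (2 + 1) * (M 2 ρ c).real X :=
          real_union_bundle_mem_le (k := 2) (by norm_num) ρ c t dd hX
      _ = 8 * (M 2 ρ c).real X := by norm_num
  -- the four events of the chain
  set E₁ : Set (BondConfig (Site 2)) := PIV (Bs z 0) with hE₁
  set E₂ : Set (BondConfig (Site 2)) := {ω | ω ∪ Bs z 0 ∈ PIV (Bs (z + Pi.single 0 1) 1)} with hE₂
  set E₃ : Set (BondConfig (Site 2)) :=
    {ω | ω ∪ Bs z 0 ∈ {ω' : BondConfig (Site 2) | ω' ∪ Bs (z + Pi.single 0 1) 1 ∈ PIV (Bs (z + Pi.single 1 1) 0)}} with hE₃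
  set E₄ : Set (BondConfig (Site 2)) :=
    {ω | ω ∪ Bs z 0 ∈ {ω' : BondConfig (Site 2) | ω' ∪ Bs (z + Pi.single 0 1) 1 ∈
      {ω'' : BondConfig (Site 2) | ω'' ∪ Bs (z + Pi.single 1 1) 0 ∈ PIV (Bs z 1)}}} with hE₄
  have hcover : {ω | IsPivotal A s(w, μ) ω} ⊆ {ω | ω \ {s(w, μ)} ∈ E₁} ∪ {ω | ω \ {s(w, μ)} ∈ E₂} ∪
      {ω | ω \ {s(w, μ)} ∈ E₃} ∪ {ω | ω \ {s(w, μ)} ∈ E₄} := by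
    intro ω hω
    rcases exists_setPivotal_side_of_isPivotal_two 2 m rfl F η r hη hηr z μ ω hwμ hfar hω with h | h | h | h
    · exact Or.inl (Or.inl (Or.inl h))
    · exact Or.inl (Or.inl (Or.inr h))
    · exact Or.inl (Or.inr h)
    · exact Or.inr h
  have h1 : (M 2 ρ c).real {ω | ω \ {s(w, μ)} ∈ E₁} ≤ 1 / (1 - c) * (M 2 ρ c).real (PIV (Bs z 0)) :=
    hclose (hPIVm _)
  have h2 : (M 2 ρ c).real {ω | ω \ {s(w, μ)} ∈ E₂} ≤
      1 / (1 - c) * (8 * (M 2 ρ c).real (PIV (Bs (z + Pi.single 0 1) 1))) := by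
    refine (hclose (hUm _ (hPIVm _))).trans ?_
    gcongr
    exact htie z 0 (hPIVm _)
  have h3 : (M 2 ρ c).real {ω | ω \ {s(w, μ)} ∈ E₃} ≤
      1 / (1 - c) * (8 * (8 * (M 2 ρ c).real (PIV (Bs (z + Pi.single 1 1) 0)))) := by
    refine (hclose (hUm _ (hUm _ (hPIVm _)))).trans ?_
    gcongr
    refine (htie z 0 (hUm _ (hPIVm _))).trans ?_
    gcongr
    exact htie _ 1 (hPIVm _)
  have h4 : (M 2 ρ c).real {ω | ω \ {s(w, μ)} ∈ E₄} ≤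
      1 / (1 - c) * (8 * (8 * (8 * (M 2 ρ c).real (PIV (Bs z 1))))) := by
    refine (hclose (hUm _ (hUm _ (hUm _ (hPIVm _))))).trans ?_
    gcongr
    refine (htie z 0 (hUm _ (hUm _ (hPIVm _)))).trans ?_
    gcongr
    refine (htie _ 1 (hUm _ (hPIVm _))).trans ?_
    gcongr
    exact htie _ 0 (hPIVm _)
  have hq : 0 ≤ 1 / (1 - c) := by positivity
  have hP : ∀ B, 0 ≤ (M 2 ρ c).real (PIV B) := fun B => measureReal_nonneg
  calc (M 2 ρ c).real {ω | IsPivotal A s(w, μ) ω}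
      ≤ (M 2 ρ c).real ({ω | ω \ {s(w, μ)} ∈ E₁} ∪ {ω | ω \ {s(w, μ)} ∈ E₂} ∪
          {ω | ω \ {s(w, μ)} ∈ E₃} ∪ {ω | ω \ {s(w, μ)} ∈ E₄}) := measureReal_mono hcover
    _ ≤ (M 2 ρ c).real {ω | ω \ {s(w, μ)} ∈ E₁} + (M 2 ρ c).real {ω | ω \ {s(w, μ)} ∈ E₂} +
          (M 2 ρ c).real {ω | ω \ {s(w, μ)} ∈ E₃} + (M 2 ρ c).real {ω | ω \ {s(w, μ)} ∈ E₄} := by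
        refine (measureReal_union_le _ _).trans (add_le_add ?_ le_rfl)
        refine (measureReal_union_le _ _).trans (add_le_add ?_ le_rfl)
        exact measureReal_union_le _ _
    _ ≤ 1 / (1 - c) * (M 2 ρ c).real (PIV (Bs z 0)) +
          1 / (1 - c) * (8 * (M 2 ρ c).real (PIV (Bs (z + Pi.single 0 1) 1))) +
          1 / (1 - c) * (8 * (8 * (M 2 ρ c).real (PIV (Bs (z + Pi.single 1 1) 0)))) +
          1 / (1 - c) * (8 * (8 * (8 * (M 2 ρ c).real (PIV (Bs z 1))))) :=
        add_le_add (add_le_add (add_le_add h1 h2) h3) h4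
    _ ≤ 585 / (1 - c) * ((M 2 ρ c).real (PIV (Bs z 0)) + (M 2 ρ c).real (PIV (Bs (z + Pi.single 0 1) 1)) +
          (M 2 ρ c).real (PIV (Bs (z + Pi.single 1 1) 0)) + (M 2 ρ c).real (PIV (Bs z 1))) := by
        have e585 : (585 : ℝ) / (1 - c) = 585 * (1 / (1 - c)) := by ring
        rw [e585]
        nlinarith [hP (Bs z 0), hP (Bs (z + Pi.single 0 1) 1), hP (Bs (z + Pi.single 1 1) 0), hP (Bs z 1),
          mul_nonneg hq (hP (Bs z 0)), mul_nonneg hq (hP (Bs (z + Pi.single 0 1) 1)),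
          mul_nonneg hq (hP (Bs (z + Pi.single 1 1) 0)), mul_nonneg hq (hP (Bs z 1))]

/-! ## The measure bound per non-axial edge -/

/-- **Corner transfer (B″₂), per interior edge** (registered helper of `stub_cornerLocalSlope`).
For `k = 2`, `0 < η`, `20η ≤ r`, any real `ρ`, `0 ≤ c < 1`, and a NON-AXIAL edge `edgeOf (v, d)`
whose two ends are drawn at distance `≥ r` from every side of every quad (the far members of the
Finset `Wn` of `stub_Dc_eq_sum_pivotal`), with `z = tb 2 (v, d)` the base of its cell:
`M_2(ρ,c)(edgeOf (v,d) pivotal for Aloc) ≤ 585/(1−c) · (M(PIV_{(z,0)}) + M(PIV_{(z+e₀,1)}) + M(PIV_{(z+e₁,0)}) + M(PIV_{(z,1)}))`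
in the currency `PIV_B = {ω ∪ B ∈ Aloc ∧ ω ∖ B ∉ Aloc}` of `Drho_add_mul_Dc_ge_of_far` (the edge is
a spoke `{2z + (1,1), μ}` of its cell: `real_isPivotal_spoke_le_two`). -/
theorem real_isPivotal_interior_le_two : ∀ (k m : ℕ), k = 2 → ∀ (F : Fin m → Quad (Set.univ : Set ℂ)) (η r : ℝ), 0 < η → 20 * η ≤ r → ∀ (ρ c : ℝ), c ∈ Set.Ico (0 : ℝ) 1 → ∀ (v : Site 2) (d : Fin 2), ¬ ax k (v, d) → (∀ x ∈ edgeOf (v, d), ∀ (i : Fin m) (j : Fin 4), ∀ p ∈ (F i).side j, r ≤ dist ((η : ℂ) * squareLatticeEmbedding.z x) p) → (M k ρ c).real {ω | IsPivotal (Aloc m F η) (edgeOf (v, d)) ω} ≤ 585 / (1 - c) * ((M k ρ c).real {ω | ω ∪ edgeOf '' {vd : Site 2 × Fin 2 | ax k vd ∧ tb k vd = tb k (v, d) ∧ vd.2 = 0} ∈ Aloc m F η ∧ ω \ edgeOf '' {vd : Site 2 × Fin 2 | ax k vd ∧ tb k vd = tb k (v, d) ∧ vd.2 = 0} ∉ Aloc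 m F η} + (M k ρ c).real {ω | ω ∪ edgeOf '' {vd : Site 2 × Fin 2 | ax k vd ∧ tb k vd = tb k (v, d) + Pi.single 0 1 ∧ vd.2 = 1} ∈ Aloc m F η ∧ ω \ edgeOf '' {vd : Site 2 × Fin 2 | ax k vd ∧ tb k vd = tb k (v, d) + Pi.single 0 1 ∧ vd.2 = 1} ∉ Aloc m F η} + (M k ρ c).real {ω | ω ∪ edgeOf '' {vd : Site 2 × Fin 2 | ax k vd ∧ tb k vd = tb k (v, d) + Pi.single 1 1 ∧ vd.2 = 0} ∈ Aloc m F η ∧ ω \ edgeOf '' {vd : Site 2 × Fin 2 | ax k vd ∧ tb k vd = tb k (v, d) + Pi.single 1 1 ∧ vd.2 = 0} ∉ Aloc m F η} + (M k ρ c).real {ω | ω ∪ edgeOf '' {vd : Site 2 × Fin 2 | ax k vd ∧ tb k vd = tb k (v, d) ∧ vd.2 = 1} ∈ Aloc m F η ∧ ω \ edgeOf '' {vd : Site 2 × Fin 2 | ax k vd ∧ tb k vd = tb k (v, d) ∧ vd.2 = 1} ∉ Aloc m F η}) := by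
  intro k m hk F η r hη hηr ρ c hc v d hax hfar
  -- the edge is a spoke of the cell `tb k (v, d)`
  set z : Site 2 := tb k (v, d) with hz
  set w : Site 2 := fun l => (k : ℤ) * z l + 1 with hw_def
  have hdv : (dirVec d : Site 2) = Pi.single d 1 := dirVec_eq_single d
  have hperp : (if d = 0 then (1 : Fin 2) else 0) ≠ d := by fin_cases d <;> decide
  have hax' : ¬ (k : ℤ) ∣ v (if d = 0 then 1 else 0) := hax
  have hzl : ∀ l, z l = v l / (k : ℤ) := fun l => rfl
  obtain ⟨μ, hμ, hwμ, hwe⟩ : ∃ μ : Site 2, edgeOf (v, d) = s(w, μ) ∧ (zdGraph 2).Adj w μ ∧ w ∈ edgeOf (v, d) := by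
    subst hk
    by_cases hvd : ((2 : ℕ) : ℤ) ∣ v d
    · -- `v + e_d` is the centre
      have hw : w = v + dirVec d := by
        funext l
        simp only [hw_def, hzl, Pi.add_apply, hdv, Pi.single_apply]
        by_cases hl : l = d
        · subst hl
          simp only [if_true]
          omega
        · have hl' : l = (if d = 0 then (1 : Fin 2) else 0) := by
            revert hl hperp
            fin_cases d <;> fin_cases l <;> simp
          rw [if_neg hl]
          rw [hl']
          rw [hl'] at hl
          push_cast at hax' ⊢
          omega
      refine ⟨v, ?_, ?_, ?_⟩
      · show s(v, v + dirVec d) = s(w, v)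
        rw [← hw, Sym2.eq_swap]
      · rw [hw, zdGraph_adj_iff]
        exact ⟨d, Or.inr (by rw [hdv])⟩
      · show w ∈ s(v, v + dirVec d)
        rw [hw]
        exact Sym2.mem_mk_right _ _
    · -- `v` is the centre
      have hw : w = v := by
        funext l
        simp only [hw_def, hzl]
        by_cases hl : l = d
        · subst hl
          push_cast at hvd ⊢
          omega
        · have hl' : l = (if d = 0 then (1 : Fin 2) else 0) := by
            revert hl hperp
            fin_cases d <;> fin_cases l <;> simp
          rw [hl']
          push_cast at hax' ⊢
          omega
      refine ⟨v + dirVec d, ?_, ?_, ?_⟩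
      · show s(v, v + dirVec d) = s(w, v + dirVec d)
        rw [hw]
      · rw [hw, zdGraph_adj_iff]
        exact ⟨d, Or.inl (by rw [hdv])⟩
      · show w ∈ s(v, v + dirVec d)
        rw [hw]
        exact Sym2.mem_mk_left _ _
  rw [hμ]
  exact real_isPivotal_spoke_le_two k m hk F η r hη hηr ρ c hc z μ hwμ (fun i j p hp => hfar w hwe i j p hp)

end Summit.CriticalPhenomena.CardyFormulaZ2.Theorems.CardySelfRefinement

end
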